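import Summits.HubbardSuperconductivity.HubbardSuperconductivity.Theorems.LiebTwinNoOnsiteODLROPairingCostOfDeviation
import Summits.HubbardSuperconductivity.HubbardSuperconductivity.Theorems.LiebTwinNoOnsiteODLROFreeEndpointToolbox
import Literature.MathematicalPhysics.QuantumLattice.HubbardPairDensityCouplingCeilingUniform

/-!
# Crux `NoOnsiteODLRO` (stmt-HubbardSuperconductivity-0933) — the WINDOW-FREE WEAK-COUPLING CEILING on the
# on-site pair density of EVERY ground state: `limsup_L S_L/L⁴ ≤ 6250·U·log²(4 + 32/√U) → 0` (`U → 0⁺`)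

`--supports stmt-HubbardSuperconductivity-0933` (routes `LiebTwin`, `EnslavedA1g`; registered by-product
stub `stub_weakCouplingOnsiteCeiling`). The crux asks, for ALL `U > 0` and `δ ∈ (0,1/2)`, that every
admissible `(N_L, S^z = 0)`-sector ground-state sequence `ψ_L` of `hubbardTorus 2 L 1 U` has
`S_L := Re ⟨ψ_L, P_sᴴP_s ψ_L⟩ = o(L⁴)` (`P_s = pairField sWave L = √2 Σ_x c_{x↑}c_{x↓}`). Every ceiling
on `S_L/L⁴` in the tree so far is either `O(1)` as `U → 0⁺` (Yang's cap; the pseudospin ceiling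
`4δ(1-δ)/w_L`, which needs a strict pair window `w_L`; the doublon bounds) or a large-`U` statement
(`128/(U - 144/√δ)²`, `U > 144/√δ`). This file proves the complementary WEAK-COUPLING ceiling, with no
window, no parity or doping hypothesis and no ground-state selection:

* `freeOnsitePairing_costs_energy_uniform_explicit` / `_rate`: ON-SITE pair LRO costs free kinetic energy
  at the level-uniform Bardeen–Cooper–Schrieffer rate — a unit `ψ ∈ szSector N 0` with
  `Re ⟨ψ, P_sᴴP_s ψ⟩ ≥ a·L⁴` has `Re ⟨ψ, H₀ψ⟩ ≥ minEnergyOn H₀ (szSector N 0) + 16a/(10⁵·log²(4 + 8/√a))·L²`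
  for `L ≥ ⌈800/√a⌉ + 3` (`P_sᴴP_s = 2·B(1)ᴴB(1)`, `|ĝ_s| = 1`: the generic pairing-cost theorem
  `freePairing_costs_energy_uniform_pairOperator` with `q = a/2`, `G = 1`);
* `onsitePairLRO_coupling_floor`: a normalised sector ground state at coupling `U ≥ 0` with on-site pair
  density `c` forces `16c/(10⁵·log²(4 + 8/√c)) ≤ U` (its free kinetic energy is at most `U·L²` above the
  free sector ground energy, `re_expect_hubbardTorus_zero_le_of_groundStateInSector`);
* `onsitePairDensity_lt_of_coupling_lt` — **the qualitative statement**: for every `ε > 0` and every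
  `0 ≤ U < 16ε/(10⁵·log²(4 + 8/√ε))`, EVERY normalised sector ground state (any `N`) at every side
  `L ≥ ⌈800/√ε⌉ + 3` has `Re ⟨ψ, P_sᴴP_s ψ⟩ < ε·L⁴`;
* `onsitePairDensity_le_mul_coupling_mul_log_sq_coupling` — closed form `c ≤ 6250·U·log²(4 + 32/√U)`,
  and `onsiteDensity_eventually_lt_of_weakCoupling` — in the crux's vocabulary: along every sequence of
  normalised `(N_L, 0)`-sector ground states (ANY `N : ℕ → ℕ`), for every `c > 6250·U·log²(4 + 32/√U)`,
  eventually `S_L/L⁴ < c`; `stub_weakCouplingOnsiteCeiling` is the registered signature (admissible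
  sequences of the crux).

So the on-site condensate density of the weakly repulsive Hubbard torus is `O(U log²(1/U))`, uniformly in
`L`, the filling and the ground state: the crux holds "to within `6250·U·log²(4+32/√U)`" at small `U` —
the approach to the free endpoint `U = 0`, where `S_L = O(L²)` exactly (`LiebTwinNoOnsiteODLROFreeEndpoint`,
`Negative/FreeEndpointTightness`). The expected truth at weak coupling is `S_L/L⁴ → 0` (no `A_{1g}` Cooper
instability of the repulsive model; `e^{-O(1/U²)}` scales for the competing channels), which is the crux.

Sources: J. Bardeen, L. N. Cooper, J. R. Schrieffer, Phys. Rev. 108 (1957) 1175, §II–III; L. Van Hove,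
Phys. Rev. 89 (1953) 1189; C. N. Yang, Rev. Mod. Phys. 34 (1962) 694, §3; H. Tasaki, Physics and
Mathematics of Quantum Many-Body Systems (2020) §2.2. Folklore finite-dimensional statements; no named
facts, no definitions. Tree: `freePairing_costs_energy_uniform_pairOperator` (this line's generic port of
`freeDWavePairing_costs_energy_uniform_explicit`), `FreeEndpoint.conjTranspose_pairField_sWave_mul_self`,
`re_expect_hubbardTorus_zero_le_of_groundStateInSector`, `le_mul_log_sq_of_le_mul_log_sq_sqrt_self'`,
`exists_eq_two_mul_of_mem_szSector_zero`, `le_sq_of_mem_szSector_two_mul_zero`.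
-/

noncomputable section

set_option linter.dupNamespace false

namespace Summit.HubbardSuperconductivity.HubbardSuperconductivity.Theorems.NoOnsiteODLRO.OnsiteCeiling

open Matrix Finset Literature.Probability.LatticeModels Literature.MathematicalPhysics.QuantumLattice
open scoped ComplexOrder ComplexConjugate

variable {L : ℕ} [NeZero L]

/-! ### The on-site pair field as an `s`-wave pair operator -/

/-- `P_sᴴ P_s = 2 · B(1)ᴴ B(1)` with `B(1) = pairOperator (fun _ => 1) univ = Σ_k c_{-k↓}c_{k↑}`
(`P_s = -√2 Σ_k b_k`). Bardeen–Cooper–Schrieffer (1957) §II; von Delft–Ralph (2001) §4.2.1. [folklore] -/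
theorem conjTranspose_pairField_sWave_eq_pairOperator :
    (pairField sWave L)ᴴ * pairField sWave L =
      ((2 : ℝ) : ℂ) • ((pairOperator (fun _ : TorusSite 2 L => (1 : ℝ)) univ)ᴴ *
        pairOperator (fun _ : TorusSite 2 L => (1 : ℝ)) univ) := by
  have hB : pairOperator (fun _ : TorusSite 2 L => (1 : ℝ)) univ = ∑ k : TorusSite 2 L, pairMode k := by
    simp only [pairOperator, Complex.ofReal_one, one_smul]
  rw [hB]
  exact FreeEndpoint.conjTranspose_pairField_sWave_mul_self

/-- On-site pair density `a` is `s`-wave pair-operator density `a/2`: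
`a·L⁴ ≤ Re ⟨ψ, P_sᴴP_s ψ⟩ → (a/2)·L⁴ ≤ Re ⟨ψ, B(1)ᴴB(1) ψ⟩`. [folklore] -/
theorem half_mul_le_re_expect_pairOperator_of_le {a : ℝ} {ψ : Fock (Orb (FermionTorus 2 L))}
    (hY : a * (L : ℝ) ^ 4 ≤ (star ψ ⬝ᵥ (((pairField sWave L)ᴴ * pairField sWave L) *ᵥ ψ)).re) :
    a / 2 * (L : ℝ) ^ 4 ≤
      (star ψ ⬝ᵥ (((pairOperator (fun _ : TorusSite 2 L => (1 : ℝ)) univ)ᴴ *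
        pairOperator (fun _ : TorusSite 2 L => (1 : ℝ)) univ) *ᵥ ψ)).re := by
  rw [conjTranspose_pairField_sWave_eq_pairOperator, Matrix.smul_mulVec, dotProduct_smul, smul_eq_mul,
    Complex.re_ofReal_mul] at hY
  linarith

/-! ### On-site pair LRO costs free kinetic energy -/

/-- **On-site pair LRO costs kinetic energy — level-uniform logarithmic rate, explicit constants.** For
`a > 0`, `L ≥ 3` with `√a·L ≥ 800`, and a unit `ψ ∈ szSector (2n) 0` (any `n`) with
`Re ⟨ψ, P_sᴴP_s ψ⟩ ≥ a·L⁴`: `minEnergyOn H₀ (szSector (2n) 0) + 16a/(10⁵·log²(4 + 8/√a))·L² ≤ Re ⟨ψ, H₀ ψ⟩`,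
`H₀ = hubbardTorus 2 L 1 0` (`freePairing_costs_energy_uniform_pairOperator` with `ĝ ≡ 1`, `G = 1`,
`q = a/2`, rate parameter `32q/G² = 16a`, `32/√(16a) = 8/√a`). Bardeen–Cooper–Schrieffer (1957) §II;
Van Hove (1953). [folklore] -/
theorem freeOnsitePairing_costs_energy_uniform_explicit {a : ℝ} (ha : 0 < a) (hL : 3 ≤ L)
    (hLa : 800 ≤ Real.sqrt a * L) {n : ℕ} {ψ : Fock (Orb (FermionTorus 2 L))}
    (hψ : ψ ∈ szSector (Λ := FermionTorus 2 L) (2 * n) 0) (h1 : star ψ ⬝ᵥ ψ = 1)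
    (hY : a * (L : ℝ) ^ 4 ≤ (star ψ ⬝ᵥ (((pairField sWave L)ᴴ * pairField sWave L) *ᵥ ψ)).re) :
    (hubbardTorus 2 L 1 0).minEnergyOn (szSector (Λ := FermionTorus 2 L) (2 * n) 0) +
        16 * a / (100000 * Real.log (4 + 8 / Real.sqrt a) ^ 2) * (L : ℝ) ^ 2 ≤
      (star ψ ⬝ᵥ (hubbardTorus 2 L 1 0 *ᵥ ψ)).re := by
  have hG : ∀ k : TorusSite 2 L, |(fun _ : TorusSite 2 L => (1 : ℝ)) k| ≤ 1 := fun _ => by simp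
  have hq : 0 < a / 2 := by positivity
  have h16 : 32 * (a / 2) / (1 : ℝ) ^ 2 = 16 * a := by ring
  have hsqrt16 : Real.sqrt (16 * a) = 4 * Real.sqrt a := by
    rw [show (16 : ℝ) * a = 4 ^ 2 * a by ring, Real.sqrt_mul (by norm_num), Real.sqrt_sq (by norm_num)]
  have hLq : 3200 ≤ Real.sqrt (32 * (a / 2) / (1 : ℝ) ^ 2) * L := by
    rw [h16, hsqrt16]
    linarith
  have h := freePairing_costs_energy_uniform_pairOperator hG one_pos hq hL hLq hψ h1
    (half_mul_le_re_expect_pairOperator_of_le hY)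
  have h8 : 32 / Real.sqrt (16 * a) = 8 / Real.sqrt a := by
    rw [hsqrt16, div_mul_eq_div_div]
    norm_num
  rwa [h16, h8] at h

/-- **On-site pair LRO costs kinetic energy — every `N`, sides beyond the threshold.** For `a > 0`,
`L ≥ ⌈800/√a⌉ + 3`, every `N` and every unit `ψ ∈ szSector N 0` with `Re ⟨ψ, P_sᴴP_s ψ⟩ ≥ a·L⁴`:
`minEnergyOn H₀ (szSector N 0) + 16a/(10⁵·log²(4 + 8/√a))·L² ≤ Re ⟨ψ, H₀ ψ⟩` (`N` is even, or the sector
is trivial). Bardeen–Cooper–Schrieffer (1957) §II. [folklore] -/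
theorem freeOnsitePairing_costs_energy_uniform_rate {a : ℝ} (ha : 0 < a) {L : ℕ} [NeZero L]
    (hL : ⌈800 / Real.sqrt a⌉₊ + 3 ≤ L) {N : ℕ} {ψ : Fock (Orb (FermionTorus 2 L))}
    (hψ : ψ ∈ szSector (Λ := FermionTorus 2 L) N 0) (h1 : star ψ ⬝ᵥ ψ = 1)
    (hY : a * (L : ℝ) ^ 4 ≤ (star ψ ⬝ᵥ (((pairField sWave L)ᴴ * pairField sWave L) *ᵥ ψ)).re) :
    (hubbardTorus 2 L 1 0).minEnergyOn (szSector (Λ := FermionTorus 2 L) N 0) +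
        16 * a / (100000 * Real.log (4 + 8 / Real.sqrt a) ^ 2) * (L : ℝ) ^ 2 ≤
      (star ψ ⬝ᵥ (hubbardTorus 2 L 1 0 *ᵥ ψ)).re := by
  have hL3 : 3 ≤ L := by omega
  have hsa : 0 < Real.sqrt a := Real.sqrt_pos.2 ha
  have hLa : 800 ≤ Real.sqrt a * L := by
    have hceil : 800 / Real.sqrt a ≤ (⌈800 / Real.sqrt a⌉₊ : ℝ) := Nat.le_ceil _
    have hL' : (⌈800 / Real.sqrt a⌉₊ : ℝ) + 3 ≤ (L : ℝ) := by exact_mod_cast hL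
    have hle : 800 / Real.sqrt a ≤ (L : ℝ) := by linarith
    rw [div_le_iff₀ hsa] at hle
    linarith
  have h0 : ψ ≠ 0 := by rintro rfl; simp at h1
  obtain ⟨n, rfl⟩ := exists_eq_two_mul_of_mem_szSector_zero hψ h0
  exact freeOnsitePairing_costs_energy_uniform_explicit ha hL3 hLa hψ h1 hY

/-! ### Ground states of the repulsive torus: the coupling floor and the weak-coupling ceiling -/

/-- **Coupling floor for on-site pair LRO in a sector ground state.** If a normalised ground state `ψ`
of `hubbardTorus 2 L 1 U` (`U ≥ 0`) in a sector `(2n, S^z = 0)`, `n ≤ L²`, `L ≥ ⌈800/√c⌉ + 3`, has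
`Re ⟨ψ, P_sᴴP_s ψ⟩ ≥ c·L⁴` (`c > 0`), then `16c/(10⁵·log²(4 + 8/√c)) ≤ U`: its free kinetic energy is at
most `U·L²` above the free sector ground energy (`re_expect_hubbardTorus_zero_le_of_groundStateInSector`),
while the on-site pair density `c` costs `16c/(10⁵·log²(4 + 8/√c))·L²`. Bardeen–Cooper–Schrieffer (1957)
§II; Tasaki (2020) §2.2. [folklore] -/
theorem onsitePairLRO_coupling_floor {c U : ℝ} (hc : 0 < c) (hU : 0 ≤ U)
    (hL : ⌈800 / Real.sqrt c⌉₊ + 3 ≤ L) {n : ℕ} (hn : n ≤ L ^ 2)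
    {ψ : Fock (Orb (FermionTorus 2 L))}
    (hψ : IsGroundStateInSector (hubbardTorus 2 L 1 U) (2 * n) 0 ψ) (h1 : star ψ ⬝ᵥ ψ = 1)
    (hY : c * (L : ℝ) ^ 4 ≤ (star ψ ⬝ᵥ (((pairField sWave L)ᴴ * pairField sWave L) *ᵥ ψ)).re) :
    16 * c / (100000 * Real.log (4 + 8 / Real.sqrt c) ^ 2) ≤ U := by
  have hcost := freeOnsitePairing_costs_energy_uniform_rate hc hL hψ.1 h1 hY
  have hfree := re_expect_hubbardTorus_zero_le_of_groundStateInSector hU hn hψ h1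
  have hL2 : (0 : ℝ) < (L : ℝ) ^ 2 := by
    have : (0 : ℝ) < (L : ℝ) := by exact_mod_cast Nat.pos_of_ne_zero (NeZero.ne L)
    positivity
  have hmul : 16 * c / (100000 * Real.log (4 + 8 / Real.sqrt c) ^ 2) * (L : ℝ) ^ 2 ≤ U * (L : ℝ) ^ 2 := by
    linarith
  exact le_of_mul_le_mul_right hmul hL2

/-- **THE QUALITATIVE STATEMENT: weak repulsion carries little on-site pair order, in every ground state.**
For `ε > 0`, `0 ≤ U < 16ε/(10⁵·log²(4 + 8/√ε))`, every side `L ≥ ⌈800/√ε⌉ + 3`, every `N` and every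
normalised ground state `ψ` of `hubbardTorus 2 L 1 U` in the sector `(N, S^z = 0)`:
`Re ⟨ψ, P_sᴴP_s ψ⟩ < ε·L⁴`. In words: `sup {limsup_L S_L/L⁴}` over all couplings `U' ≤ U`, fillings and
ground-state selections tends to `0` as `U → 0⁺` — the on-site channel of the weakly repulsive Hubbard
torus carries no macroscopic condensate beyond `O(U log²(1/U))`. Bardeen–Cooper–Schrieffer (1957) §II;
Yang (1962) §3. [folklore] -/
theorem onsitePairDensity_lt_of_coupling_lt {ε U : ℝ} (hε : 0 < ε) (hU0 : 0 ≤ U)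
    (hU : U < 16 * ε / (100000 * Real.log (4 + 8 / Real.sqrt ε) ^ 2))
    (hL : ⌈800 / Real.sqrt ε⌉₊ + 3 ≤ L) {N : ℕ} {ψ : Fock (Orb (FermionTorus 2 L))}
    (hψ : IsGroundStateInSector (hubbardTorus 2 L 1 U) N 0 ψ) (h1 : star ψ ⬝ᵥ ψ = 1) :
    (star ψ ⬝ᵥ (((pairField sWave L)ᴴ * pairField sWave L) *ᵥ ψ)).re < ε * (L : ℝ) ^ 4 := by
  by_contra h
  push Not at h
  have h0 : ψ ≠ 0 := by rintro rfl; simp at h1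
  obtain ⟨n, rfl⟩ := exists_eq_two_mul_of_mem_szSector_zero hψ.1 h0
  have hn := le_sq_of_mem_szSector_two_mul_zero hψ.1 h0
  have := onsitePairLRO_coupling_floor hε hU0 hL hn hψ h1 h
  linarith

/-- **Implicit ceiling**: a normalised `(2n, 0)`-sector ground state (`n ≤ L²`, `L ≥ ⌈800/√c⌉ + 3`,
`U ≥ 0`) with on-site pair density `c > 0` has `c ≤ 6250·U·log²(4 + 32/√c)` (`10⁵/16 = 6250`;
`log(4 + 8/√c) ≤ log(4 + 32/√c)`). [folklore] -/
theorem onsitePairDensity_le_mul_coupling_mul_log_sq {c U : ℝ} (hc : 0 < c) (hU : 0 ≤ U)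
    (hL : ⌈800 / Real.sqrt c⌉₊ + 3 ≤ L) {n : ℕ} (hn : n ≤ L ^ 2)
    {ψ : Fock (Orb (FermionTorus 2 L))}
    (hψ : IsGroundStateInSector (hubbardTorus 2 L 1 U) (2 * n) 0 ψ) (h1 : star ψ ⬝ᵥ ψ = 1)
    (hY : c * (L : ℝ) ^ 4 ≤ (star ψ ⬝ᵥ (((pairField sWave L)ᴴ * pairField sWave L) *ᵥ ψ)).re) :
    c ≤ 6250 * U * Real.log (4 + 32 / Real.sqrt c) ^ 2 := by
  have h := onsitePairLRO_coupling_floor hc hU hL hn hψ h1 hY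
  have hlog1 : 1 ≤ Real.log (4 + 8 / Real.sqrt c) := by
    have hlog4 : (1 : ℝ) ≤ Real.log 4 := by
      rw [← Real.log_exp 1]
      refine Real.log_le_log (Real.exp_pos 1) ?_
      have := Real.exp_one_lt_d9
      linarith
    refine hlog4.trans (Real.log_le_log (by norm_num) ?_)
    have : 0 ≤ 8 / Real.sqrt c := div_nonneg (by norm_num) (Real.sqrt_nonneg _)
    linarith
  have hlog : 0 < Real.log (4 + 8 / Real.sqrt c) ^ 2 := by positivity
  rw [div_le_iff₀ (by positivity)] at h
  -- `log(4 + 8/√c) ≤ log(4 + 32/√c)`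
  have hmono : Real.log (4 + 8 / Real.sqrt c) ≤ Real.log (4 + 32 / Real.sqrt c) := by
    refine Real.log_le_log (by positivity) ?_
    have : 8 / Real.sqrt c ≤ 32 / Real.sqrt c :=
      div_le_div_of_nonneg_right (by norm_num) (Real.sqrt_nonneg _)
    linarith
  have hsq : Real.log (4 + 8 / Real.sqrt c) ^ 2 ≤ Real.log (4 + 32 / Real.sqrt c) ^ 2 :=
    pow_le_pow_left₀ (by linarith) hmono 2
  have hU' : 0 ≤ 6250 * U := by positivity
  nlinarith [mul_le_mul_of_nonneg_left hsq hU']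

/-- **Closed form: the ground-state on-site pair density at ANY filling is at most
`6250·U·log²(4 + 32/√U)`.** Under the hypotheses of `onsitePairDensity_le_mul_coupling_mul_log_sq` and
`U > 0`: `c ≤ 6250·U·log²(4 + 32/√U)` — `O(U log²(1/U))` as `U → 0⁺`, uniformly in the filling, the side
(beyond `⌈800/√c⌉ + 3`) and the choice of ground state. Bardeen–Cooper–Schrieffer (1957) §II–III;
Van Hove (1953). [folklore] -/
theorem onsitePairDensity_le_mul_coupling_mul_log_sq_coupling {c U : ℝ} (hc : 0 < c) (hU : 0 < U)
    (hL : ⌈800 / Real.sqrt c⌉₊ + 3 ≤ L) {n : ℕ} (hn : n ≤ L ^ 2)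
    {ψ : Fock (Orb (FermionTorus 2 L))}
    (hψ : IsGroundStateInSector (hubbardTorus 2 L 1 U) (2 * n) 0 ψ) (h1 : star ψ ⬝ᵥ ψ = 1)
    (hY : c * (L : ℝ) ^ 4 ≤ (star ψ ⬝ᵥ (((pairField sWave L)ᴴ * pairField sWave L) *ᵥ ψ)).re) :
    c ≤ 6250 * U * Real.log (4 + 32 / Real.sqrt U) ^ 2 :=
  le_mul_log_sq_of_le_mul_log_sq_sqrt_self' hc (by norm_num) hU
    (onsitePairDensity_le_mul_coupling_mul_log_sq hc hU.le hL hn hψ h1 hY)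

/-- **A-priori form, closed, every `N`.** For `U > 0`, `c > 6250·U·log²(4 + 32/√U)`, all sides
`L ≥ ⌈800/√c⌉ + 3`, every `N` and every normalised ground state `ψ` of `hubbardTorus 2 L 1 U` in the sector
`(N, S^z = 0)`: `Re ⟨ψ, P_sᴴP_s ψ⟩ < c·L⁴`. [folklore] -/
theorem onsitePairDensity_lt_of_log_sq_coupling_lt {c U : ℝ} (hU : 0 < U)
    (hcU : 6250 * U * Real.log (4 + 32 / Real.sqrt U) ^ 2 < c)
    (hL : ⌈800 / Real.sqrt c⌉₊ + 3 ≤ L) {N : ℕ} {ψ : Fock (Orb (FermionTorus 2 L))}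
    (hψ : IsGroundStateInSector (hubbardTorus 2 L 1 U) N 0 ψ) (h1 : star ψ ⬝ᵥ ψ = 1) :
    (star ψ ⬝ᵥ (((pairField sWave L)ᴴ * pairField sWave L) *ᵥ ψ)).re < c * (L : ℝ) ^ 4 := by
  have hc : 0 < c := lt_trans (mul_mul_log_sq_four_add_pos (by norm_num) hU) hcU
  by_contra h
  push Not at h
  have h0 : ψ ≠ 0 := by rintro rfl; simp at h1
  obtain ⟨n, rfl⟩ := exists_eq_two_mul_of_mem_szSector_zero hψ.1 h0
  have hn := le_sq_of_mem_szSector_two_mul_zero hψ.1 h0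
  have := onsitePairDensity_le_mul_coupling_mul_log_sq_coupling hc hU hL hn hψ h1 h
  linarith

/-! ### The crux's vocabulary: sequences of sector ground states -/

omit [NeZero L] in
/-- **Weak-coupling on-site ceiling along ground-state sequences (any electron numbers).** For `U > 0`,
ANY `N : ℕ → ℕ` and any family `ψ_L` of normalised `(N_L, S^z = 0)`-sector ground states of
`hubbardTorus 2 L 1 U` at the even sides: for every `c > 6250·U·log²(4 + 32/√U)` there is `L₀` with
`Re ⟨ψ_L, P_sᴴP_s ψ_L⟩ / L⁴ < c` for all even `L ≥ L₀`; i.e. `limsup_L S_L/L⁴ ≤ 6250·U·log²(4 + 32/√U)`,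
window-free. Bardeen–Cooper–Schrieffer (1957) §II; Yang (1962) §3. [folklore] -/
theorem onsiteDensity_eventually_lt_of_weakCoupling {U : ℝ} (hU : 0 < U)
    (N : ℕ → ℕ) (ψ : ∀ L, Fock (Orb (FermionTorus 2 L)))
    (hyp : ∀ L, Even L → star (ψ L) ⬝ᵥ ψ L = 1 ∧ IsGroundStateInSector (hubbardTorus 2 L 1 U) (N L) 0 (ψ L))
    {c : ℝ} (hcU : 6250 * U * Real.log (4 + 32 / Real.sqrt U) ^ 2 < c) :
    ∃ L₀ : ℕ, ∀ (L : ℕ) [NeZero L], Even L → L₀ ≤ L →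
      (expect ((pairField sWave L)ᴴ * pairField sWave L) (ψ L)).re / (L : ℝ) ^ 4 < c := by
  refine ⟨⌈800 / Real.sqrt c⌉₊ + 3, fun L _ hLe hL => ?_⟩
  obtain ⟨h1, hgs⟩ := hyp L hLe
  have h := onsitePairDensity_lt_of_log_sq_coupling_lt hU hcU hL hgs h1
  have hL4 : (0 : ℝ) < (L : ℝ) ^ 4 := by
    have : (0 : ℝ) < (L : ℝ) := by exact_mod_cast Nat.pos_of_ne_zero (NeZero.ne L)
    positivity
  rw [div_lt_iff₀ hL4]
  exact h

/-- REGISTERED STUB `stub_weakCouplingOnsiteCeiling` of crux stmt-HubbardSuperconductivity-0933 (verbatim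
signature; a BY-PRODUCT — the window-free weak-coupling ceiling — not a piece of a composition
`NoOnsiteODLRO_of`): for all `U > 0`, `δ ∈ (0,1/2)` and every admissible `(N_L, 0)`-sector ground-state
sequence of the crux, and every `c > 6250·U·log²(4 + 32/√U)`, eventually in even `L`:
`Re ⟨ψ_L, P_sᴴP_s ψ_L⟩ / L⁴ < c` (`= onsiteDensity_eventually_lt_of_weakCoupling`; the filling clause is not
used). [folklore] -/
theorem stub_weakCouplingOnsiteCeiling :
    open Literature.MathematicalPhysics.QuantumLattice in
    ∀ (U δ : ℝ), 0 < U → δ ∈ Set.Ioo (0 : ℝ) (1 / 2) →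
      ∀ (N : ℕ → ℕ) (ψ : ∀ L, Fock (Orb (FermionTorus 2 L))),
        (∀ L, Even L → N L = 2 * ⌊(1 - δ) * (L : ℝ) ^ 2 / 2⌋₊ ∧ star (ψ L) ⬝ᵥ ψ L = 1 ∧
            IsGroundStateInSector (hubbardTorus 2 L 1 U) (N L) 0 (ψ L)) →
          ∀ c : ℝ, 6250 * U * Real.log (4 + 32 / Real.sqrt U) ^ 2 < c →
            ∃ L₀ : ℕ, ∀ (L : ℕ) [NeZero L], Even L → L₀ ≤ L →
              (expect ((pairField sWave L)ᴴ * pairField sWave L) (ψ L)).re / (L : ℝ) ^ 4 < c :=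
  fun _ _ hU _ N ψ hyp _ hcU =>
    onsiteDensity_eventually_lt_of_weakCoupling hU N ψ (fun L hL => (hyp L hL).2) hcU

end Summit.HubbardSuperconductivity.HubbardSuperconductivity.Theorems.NoOnsiteODLRO.OnsiteCeiling
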